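import Summits.Ventures.CertifiedQuantumChemistry.Rows.HubbardRingTVDihedralSymmetry
import Literature.MathematicalPhysics.QuantumChemistry.RelaxationRealRestriction
import HarnessLib

/-!
# Ventures/CertifiedQuantumChemistry — Rows/HubbardRingTVDihedralSymmetrySinglet.lean: the dihedral
# symmetry at the SINGLET-RESTRICTED level (`DQG+S²`) — orbital symmetry averaging for
# `IsDQGFeasibleSinglet`, losslessness of dihedral blocking, an invariant optimal pair, uniform
# occupations (`1/2` at every site and spin at half filling)

HONEST FRAMING (verbatim): certified bounds for a stated model Hamiltonian in a stated basis; not a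
claim about the real molecule beyond that model.

Seat rdm-B, ROWS courtesy file (theorems only; no `def`, no notation, no instance; zero compute). The
sequel of `Rows/HubbardRingTVDihedralSymmetry.lean` (the `S_z`-sector DQG level) for the conjecture leaf's
second level `OPT_DQG+S² = Model.pqgSingletEnergy` (the sector programme at `(n, n)` plus Mazziotti's
`S`-representability row (98) at `S = M = 0`, feasible set `IsDQGFeasibleSinglet n`). The tree's
Gatermann–Parrilo file `Literature/…/RelaxationSymmetryAveraging.lean` treats the `N`-electron, the
`S_z`-sector and the `PQGT1T2′` programmes; the singlet-restricted one is supplied here: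

* §1 (abstract `Λ`, any orbital symmetry group `ρ : G →* Equiv.Perm Λ` of the tables)
  `SingletAveraging.isDQGFeasibleSinglet_submatrix_mapEquiv` (the `S`-row `Σ_{xy} Γ_{(x↑,y↓),(y↑,x↓)} = n`
  is invariant under spin-preserving orbital relabellings, so the singlet-feasible set is),
  `isDQGFeasibleSinglet_average` (the Reynolds average of a singlet-feasible pair is singlet-feasible —
  convexity is the tree's `IsDQGFeasibleSinglet.sum_smul`), **`le_pqgSingletEnergy_iff_invariant`**
  (Theorem 3.3: the `ρ`-invariant singlet programme has the same value) and
  **`exists_invariant_isDQGFeasibleSinglet_rdmEnergy_eq_pqgSingletEnergy`** (the minimum is attained at a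
  `ρ`-invariant singlet-feasible pair).
* §2 THE RING: **`hubbardRingTV_le_pqgSingletEnergy_iff_dihedral`** (dihedral blocking is lossless for
  `OPT_DQG+S²(hubbardRingTV L t U; n)`, `n ≤ L`), **`hubbardRingTV_exists_dihedral_singlet_optimum`**,
  **`hubbardRingTV_exists_uniform_singlet_optimum`** (an OPTIMAL singlet-feasible pair with
  `γ_{pσ,pσ} = n/L` at every site and spin and uniform doublon weight) and
  **`hubbardRingTV_exists_halfFilled_singlet_optimum`** (`L = 2n`, `n ≥ 1`: `γ_{pσ,pσ} = 1/2`).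

READING: statements about the ABSTRACT singlet-restricted programme and the cell's own model object;
the spin flip / spin adaptation is the business of `Rows/SingletSpinAdaptationLossless*.lean` and is
not repeated; no certificate, row, claim node or value of record depends on this file; no certified
primal point is asserted or read. All PROVED (0 sorry, standard axioms); no definitions, no named
facts. References (docstring-only): K. Gatermann, P. A. Parrilo, J. Pure Appl. Algebra 192 (2004) 95,
§3 Thm 3.3; D. A. Mazziotti, Adv. Chem. Phys. 134 (2007) ch. 3 §II.F.1 eq. (98). Tree (REUSED):
`IsDQGFeasibleSinglet(.sum_smul)`, `IsDQGFeasibleSector.submatrix_mapEquiv`, `rdmEnergy_average`,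
`rdmEnergy_submatrix_mapPerm`, `average_one_submatrix`, `average_two_submatrix`,
`le_pqgSingletEnergy_iff`, `pqgSingletEnergy_le_rdmEnergy`,
`exists_isDQGFeasibleSinglet_rdmEnergy_eq_pqgSingletEnergy` (Literature); `hubbardRingTV_tables_dihedral`,
`RingSymmetry.entrywise_of_submatrix`, `one_diag_up_eq_div`, `one_diag_down_eq_div`, `two_doublon_eq_div`
(the sibling file).
-/

noncomputable section

namespace Summit.Ventures.CertifiedQuantumChemistry

open Matrix Finset
open Literature.MathematicalPhysics.QuantumLattice Literature.MathematicalPhysics.QuantumChemistry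
open Summit.Ventures.CertifiedQuantumChemistry.Hamiltonians
open scoped ComplexOrder

/-! ## §1 Orbital symmetry averaging for the singlet-restricted programme -/

namespace SingletAveraging

section Abstract

variable {Λ : Type*} [LinearOrder Λ] [Fintype Λ]
variable {G : Type*} [Group G] [Fintype G]

/-- **Spin-preserving orbital relabellings preserve the singlet-feasible set**: the `S`-representability
row `Σ_{x,y} Γ_{(x↑,y↓),(y↑,x↓)} = n` is a double sum over the orbitals, invariant under reindexing both
by `f : Λ ≃ Λ`; the sector rows are the tree's `IsDQGFeasibleSector.submatrix_mapEquiv`. [folklore] -/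
theorem isDQGFeasibleSinglet_submatrix_mapEquiv {n : ℕ} {γ : Matrix (Orb Λ) (Orb Λ) ℂ}
    {Γ : Matrix (Orb Λ × Orb Λ) (Orb Λ × Orb Λ) ℂ} (h : IsDQGFeasibleSinglet n γ Γ) (f : Λ ≃ Λ) :
    IsDQGFeasibleSinglet n (γ.submatrix (Orb.mapEquiv f) (Orb.mapEquiv f))
      (Γ.submatrix (Prod.map (Orb.mapEquiv f) (Orb.mapEquiv f))
        (Prod.map (Orb.mapEquiv f) (Orb.mapEquiv f))) where
  toIsDQGFeasibleSector := h.toIsDQGFeasibleSector.submatrix_mapEquiv f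
  exchange_sum := by
    simp only [submatrix_apply, Prod.map_apply, Orb.mapEquiv_orb]
    rw [f.sum_comp (fun x => ∑ y, Γ (orb x 0, orb (f y) 1) (orb (f y) 0, orb x 1)), ← h.exchange_sum]
    exact Finset.sum_congr rfl fun x _ =>
      f.sum_comp (fun y => Γ (orb x 0, orb y 1) (orb y 0, orb x 1))

omit [LinearOrder Λ] [Fintype Λ] in
/-- The uniform weights `1/|G|` sum to one. [folklore] -/
theorem sum_card_inv_eq_one : ∑ _g : G, ((Fintype.card G : ℝ)⁻¹ : ℝ) = 1 := by
  rw [Finset.sum_const, Finset.card_univ, nsmul_eq_mul,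
    mul_inv_cancel₀ (Nat.cast_ne_zero.mpr (Fintype.card_pos_iff.mpr ⟨1⟩).ne')]

/-- **The group average of a singlet-feasible pair is singlet-feasible** (orbital symmetry group
`ρ : G →* Equiv.Perm Λ`, lifted to the spin orbitals by `Orb.mapPerm`; convexity of the singlet-feasible
set is the tree's `IsDQGFeasibleSinglet.sum_smul`). [folklore] -/
theorem isDQGFeasibleSinglet_average (ρ : G →* Equiv.Perm Λ) {n : ℕ}
    {γ : Matrix (Orb Λ) (Orb Λ) ℂ} {Γ : Matrix (Orb Λ × Orb Λ) (Orb Λ × Orb Λ) ℂ}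
    (h : IsDQGFeasibleSinglet n γ Γ) :
    IsDQGFeasibleSinglet n
      (∑ g : G, (((Fintype.card G : ℝ)⁻¹ : ℝ) : ℂ) •
        γ.submatrix ((Orb.mapPerm.comp ρ) g) ((Orb.mapPerm.comp ρ) g))
      (∑ g : G, (((Fintype.card G : ℝ)⁻¹ : ℝ) : ℂ) •
        Γ.submatrix (Prod.map ((Orb.mapPerm.comp ρ) g) ((Orb.mapPerm.comp ρ) g))
          (Prod.map ((Orb.mapPerm.comp ρ) g) ((Orb.mapPerm.comp ρ) g))) :=
  IsDQGFeasibleSinglet.sum_smul Finset.univ (fun _ => (Fintype.card G : ℝ)⁻¹)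
    (fun _ _ => inv_nonneg.mpr (Nat.cast_nonneg _)) sum_card_inv_eq_one fun g _ => by
      simp only [MonoidHom.coe_comp, Function.comp_apply, Orb.mapPerm_apply]
      exact isDQGFeasibleSinglet_submatrix_mapEquiv h (ρ g)

/-- **Theorem 3.3 for the singlet-restricted programme `E_PQG(2n, S = 0)`**: if the integral tables are
invariant under an orbital symmetry group `ρ : G →* Equiv.Perm Λ`, then `c ≤ E_PQG^singlet(n)` iff `c`
lies below the functional on the `ρ`-INVARIANT singlet-feasible pairs (`n ≤ |Λ|`). [folklore] -/
theorem le_pqgSingletEnergy_iff_invariant (h : Λ → Λ → ℂ) (g₂ : Λ → Λ → Λ → Λ → ℂ) (hnuc : ℂ)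
    {n : ℕ} (hn : n ≤ Fintype.card Λ) (ρ : G →* Equiv.Perm Λ)
    (hh : ∀ (x : G) p q, h (ρ x p) (ρ x q) = h p q)
    (hg : ∀ (x : G) p q r s, g₂ (ρ x p) (ρ x q) (ρ x r) (ρ x s) = g₂ p q r s) {c : ℝ} :
    c ≤ pqgSingletEnergy h g₂ hnuc n ↔
      ∀ γ Γ, IsDQGFeasibleSinglet n γ Γ →
        (∀ x : G, γ.submatrix ((Orb.mapPerm.comp ρ) x) ((Orb.mapPerm.comp ρ) x) = γ ∧
            Γ.submatrix (Prod.map ((Orb.mapPerm.comp ρ) x) ((Orb.mapPerm.comp ρ) x))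
              (Prod.map ((Orb.mapPerm.comp ρ) x) ((Orb.mapPerm.comp ρ) x)) = Γ) →
          c ≤ (rdmEnergy h g₂ hnuc γ Γ).re := by
  rw [le_pqgSingletEnergy_iff h g₂ hnuc hn]
  constructor
  · intro hc γ Γ hf _
    exact hc γ Γ hf
  · intro hc γ Γ hf
    rw [← rdmEnergy_average h g₂ hnuc (Orb.mapPerm.comp ρ)
      (rdmEnergy_submatrix_mapPerm h g₂ hnuc ρ hh hg) γ Γ]
    exact hc _ _ (isDQGFeasibleSinglet_average ρ hf) fun x =>
      ⟨average_one_submatrix _ _ γ x, average_two_submatrix _ _ Γ x⟩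

/-- **The singlet-restricted minimum is attained at a `ρ`-invariant singlet-feasible pair** (average a
minimiser, `exists_isDQGFeasibleSinglet_rdmEnergy_eq_pqgSingletEnergy`, over the orbital symmetry
group). [folklore] -/
theorem exists_invariant_isDQGFeasibleSinglet_rdmEnergy_eq_pqgSingletEnergy (h : Λ → Λ → ℂ)
    (g₂ : Λ → Λ → Λ → Λ → ℂ) (hnuc : ℂ) {n : ℕ} (hn : n ≤ Fintype.card Λ) (ρ : G →* Equiv.Perm Λ)
    (hh : ∀ (x : G) p q, h (ρ x p) (ρ x q) = h p q)
    (hg : ∀ (x : G) p q r s, g₂ (ρ x p) (ρ x q) (ρ x r) (ρ x s) = g₂ p q r s) :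
    ∃ γ Γ, IsDQGFeasibleSinglet n γ Γ ∧
      (∀ x : G, γ.submatrix ((Orb.mapPerm.comp ρ) x) ((Orb.mapPerm.comp ρ) x) = γ ∧
          Γ.submatrix (Prod.map ((Orb.mapPerm.comp ρ) x) ((Orb.mapPerm.comp ρ) x))
            (Prod.map ((Orb.mapPerm.comp ρ) x) ((Orb.mapPerm.comp ρ) x)) = Γ) ∧
        (rdmEnergy h g₂ hnuc γ Γ).re = pqgSingletEnergy h g₂ hnuc n := by
  obtain ⟨γ, Γ, hf, hE0⟩ := exists_isDQGFeasibleSinglet_rdmEnergy_eq_pqgSingletEnergy h g₂ hnuc hn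
  refine ⟨_, _, isDQGFeasibleSinglet_average ρ hf,
    fun x => ⟨average_one_submatrix _ _ γ x, average_two_submatrix _ _ Γ x⟩, ?_⟩
  rw [rdmEnergy_average h g₂ hnuc (Orb.mapPerm.comp ρ)
    (rdmEnergy_submatrix_mapPerm h g₂ hnuc ρ hh hg) γ Γ, hE0]

end Abstract

end SingletAveraging

/-! ## §2 The ring: dihedral blocking at the singlet level, a uniform singlet optimum -/

section Ring

variable {L : ℕ}

open RingSymmetry SingletAveraging

/-- **DIHEDRAL BLOCKING IS LOSSLESS FOR THE SINGLET-RESTRICTED PROGRAMME OF THE RING**: for `n ≤ L`,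
`c ≤ OPT_DQG+S²(hubbardRingTV L t U; n)` iff `c` lies below the functional on the singlet-feasible pairs
invariant under every rotation and reflection of the sites. [folklore] -/
theorem hubbardRingTV_le_pqgSingletEnergy_iff_dihedral (t U : ℚ) {n : ℕ} (hn : n ≤ L) {c : ℝ} :
    c ≤ Model.pqgSingletEnergy (hubbardRingTV L t U) n ↔
      ∀ γ Γ, IsDQGFeasibleSinglet n γ Γ →
        (∀ x ∈ Subgroup.closure ({finRotate L, Fin.revPerm} : Set (Equiv.Perm (Fin L))),
            γ.submatrix (Orb.mapEquiv x) (Orb.mapEquiv x) = γ ∧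
              Γ.submatrix (Prod.map (Orb.mapEquiv x) (Orb.mapEquiv x))
                (Prod.map (Orb.mapEquiv x) (Orb.mapEquiv x)) = Γ) →
          c ≤ (rdmEnergy (fun p q => ((hubbardRingTV L t U).h p q : ℂ))
            (fun p q r s => ((hubbardRingTV L t U).eri p q r s : ℂ))
            ((hubbardRingTV L t U).ecore : ℂ) γ Γ).re := by
  classical
  have hn' : n ≤ Fintype.card (Fin L) := by rw [Fintype.card_fin]; exact hn
  set H := Subgroup.closure ({finRotate L, Fin.revPerm} : Set (Equiv.Perm (Fin L)))
  have hh : ∀ (x : ↥H) (p q : Fin L), ((hubbardRingTV L t U).h (H.subtype x p) (H.subtype x q) : ℂ) =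
      ((hubbardRingTV L t U).h p q : ℂ) := fun x p q => by
    rw [Subgroup.coe_subtype, (hubbardRingTV_tables_dihedral t U x.2).1]
  have hg : ∀ (x : ↥H) (p q r s : Fin L), ((hubbardRingTV L t U).eri (H.subtype x p) (H.subtype x q)
      (H.subtype x r) (H.subtype x s) : ℂ) = ((hubbardRingTV L t U).eri p q r s : ℂ) := fun x p q r s => by
    rw [Subgroup.coe_subtype, (hubbardRingTV_tables_dihedral t U x.2).2]
  unfold Model.pqgSingletEnergy
  rw [le_pqgSingletEnergy_iff_invariant _ _ _ hn' H.subtype hh hg]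
  simp only [MonoidHom.coe_comp, Function.comp_apply, Orb.mapPerm_apply, Subgroup.coe_subtype,
    Subtype.forall]

/-- **AN OPTIMAL DIHEDRAL-INVARIANT SINGLET-FEASIBLE PAIR EXISTS** for `OPT_DQG+S²(hubbardRingTV L t U; n)`
(`n ≤ L`, every `t, U`). [folklore] -/
theorem hubbardRingTV_exists_dihedral_singlet_optimum (t U : ℚ) {n : ℕ} (hn : n ≤ L) :
    ∃ γ Γ, IsDQGFeasibleSinglet n γ Γ ∧
      (∀ x ∈ Subgroup.closure ({finRotate L, Fin.revPerm} : Set (Equiv.Perm (Fin L))),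
          γ.submatrix (Orb.mapEquiv x) (Orb.mapEquiv x) = γ ∧
            Γ.submatrix (Prod.map (Orb.mapEquiv x) (Orb.mapEquiv x))
              (Prod.map (Orb.mapEquiv x) (Orb.mapEquiv x)) = Γ) ∧
        (rdmEnergy (fun p q => ((hubbardRingTV L t U).h p q : ℂ))
            (fun p q r s => ((hubbardRingTV L t U).eri p q r s : ℂ))
            ((hubbardRingTV L t U).ecore : ℂ) γ Γ).re = Model.pqgSingletEnergy (hubbardRingTV L t U) n := by
  classical
  have hn' : n ≤ Fintype.card (Fin L) := by rw [Fintype.card_fin]; exact hn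
  set H := Subgroup.closure ({finRotate L, Fin.revPerm} : Set (Equiv.Perm (Fin L)))
  have hh : ∀ (x : ↥H) (p q : Fin L), ((hubbardRingTV L t U).h (H.subtype x p) (H.subtype x q) : ℂ) =
      ((hubbardRingTV L t U).h p q : ℂ) := fun x p q => by
    rw [Subgroup.coe_subtype, (hubbardRingTV_tables_dihedral t U x.2).1]
  have hg : ∀ (x : ↥H) (p q r s : Fin L), ((hubbardRingTV L t U).eri (H.subtype x p) (H.subtype x q)
      (H.subtype x r) (H.subtype x s) : ℂ) = ((hubbardRingTV L t U).eri p q r s : ℂ) := fun x p q r s => by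
    rw [Subgroup.coe_subtype, (hubbardRingTV_tables_dihedral t U x.2).2]
  obtain ⟨γ, Γ, hf, hinv, hE⟩ := exists_invariant_isDQGFeasibleSinglet_rdmEnergy_eq_pqgSingletEnergy
    (fun p q => ((hubbardRingTV L t U).h p q : ℂ)) (fun p q r s => ((hubbardRingTV L t U).eri p q r s : ℂ))
    ((hubbardRingTV L t U).ecore : ℂ) hn' H.subtype hh hg
  refine ⟨γ, Γ, hf, fun x hx => ?_, hE⟩
  simpa only [MonoidHom.coe_comp, Function.comp_apply, Orb.mapPerm_apply, Subgroup.coe_subtype] using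
    hinv ⟨x, hx⟩

/-- **A UNIFORM OPTIMAL SINGLET-FEASIBLE PAIR EXISTS**: for every `t, U` and `n ≤ L` the singlet-restricted
programme of `hubbardRingTV L t U` has an OPTIMAL feasible pair with `γ_{pσ,pσ} = n/L` at every site and
spin and site-independent doublon weight `d_p = s/L`. [folklore] -/
theorem hubbardRingTV_exists_uniform_singlet_optimum (t U : ℚ) {n : ℕ} (hn : n ≤ L) :
    ∃ γ Γ, IsDQGFeasibleSinglet n γ Γ ∧
      (rdmEnergy (fun p q => ((hubbardRingTV L t U).h p q : ℂ))
          (fun p q r s => ((hubbardRingTV L t U).eri p q r s : ℂ))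
          ((hubbardRingTV L t U).ecore : ℂ) γ Γ).re = Model.pqgSingletEnergy (hubbardRingTV L t U) n ∧
      (∀ (p : Fin L) (σ : Fin 2), γ (orb p σ) (orb p σ) = (n : ℂ) / L) ∧
      ∀ p : Fin L, Γ (orb p 0, orb p 1) (orb p 0, orb p 1) =
        (∑ q : Fin L, Γ (orb q 0, orb q 1) (orb q 0, orb q 1)) / L := by
  obtain ⟨γ, Γ, hf, hinv, hE⟩ := hubbardRingTV_exists_dihedral_singlet_optimum (L := L) t U hn
  have hr : finRotate L ∈ Subgroup.closure ({finRotate L, Fin.revPerm} : Set (Equiv.Perm (Fin L))) :=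
    Subgroup.subset_closure (Set.mem_insert _ _)
  obtain ⟨hγ, hΓ⟩ := entrywise_of_submatrix (hinv _ hr).1 (hinv _ hr).2
  refine ⟨γ, Γ, hf, hE, fun p σ => ?_, two_doublon_eq_div hΓ⟩
  fin_cases σ
  · exact one_diag_up_eq_div hf.toIsDQGFeasibleSector hγ p
  · exact one_diag_down_eq_div hf.toIsDQGFeasibleSector hγ p

/-- **LOCAL HALF FILLING AT A SYMMETRIC SINGLET OPTIMUM**: on the half-filled even ring (`L = 2n`,
`n ≥ 1`, every `t, U`) the singlet-restricted programme `OPT_DQG+S²(hubbardRingTV (2n) t U; n)` has an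
optimal feasible pair with `γ_{pσ,pσ} = 1/2` at EVERY site and spin and uniform doublon weight. [folklore] -/
theorem hubbardRingTV_exists_halfFilled_singlet_optimum {n : ℕ} (hn : 1 ≤ n) (t U : ℚ) :
    ∃ γ Γ, IsDQGFeasibleSinglet n γ Γ ∧
      (rdmEnergy (fun p q => ((hubbardRingTV (2 * n) t U).h p q : ℂ))
          (fun p q r s => ((hubbardRingTV (2 * n) t U).eri p q r s : ℂ))
          ((hubbardRingTV (2 * n) t U).ecore : ℂ) γ Γ).re =
        Model.pqgSingletEnergy (hubbardRingTV (2 * n) t U) n ∧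
      (∀ (p : Fin (2 * n)) (σ : Fin 2), γ (orb p σ) (orb p σ) = 1 / 2) ∧
      ∀ p q : Fin (2 * n), Γ (orb p 0, orb p 1) (orb p 0, orb p 1) = Γ (orb q 0, orb q 1) (orb q 0, orb q 1) := by
  obtain ⟨γ, Γ, hf, hE, hocc, hd⟩ :=
    hubbardRingTV_exists_uniform_singlet_optimum (L := 2 * n) t U (show n ≤ 2 * n by omega)
  have hhalf : ((n : ℂ)) / ((2 * n : ℕ) : ℂ) = 1 / 2 := by
    have hn0 : (n : ℂ) ≠ 0 := Nat.cast_ne_zero.2 (by omega)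
    rw [Nat.cast_mul, Nat.cast_ofNat]
    field_simp
  exact ⟨γ, Γ, hf, hE, fun p σ => (hocc p σ).trans hhalf, fun p q => by rw [hd p, hd q]⟩

end Ring

end Summit.Ventures.CertifiedQuantumChemistry

end
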